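import Summits.RiemannHypothesis.RiemannHypothesis.Theorems.PfPersistenceFfGram

/-!
# Motivic door, ff calibration: THE CLIFF — kernel and definiteness of the window form for Frobenius
data WITH REPEATED EIGENVALUES
(pub-rhdoor, unit `ffcal`, HOME/FFCAL.md §0 A2/A3 and §5; seat planner-pub-rhdoor-ffcal-g3-0)

HONEST FRAMING (cell charter, verbatim): lottery ticket at the motivic door; RH probability negligible;
consolation prizes are real: a new semi-local Weil-positivity theorem, or a located gap in the
Connes–Consani programme, plus the ff-door theorem.  Nothing in this file is a statement about `ζ`.

Setting of `PfPersistenceFfAngleTwin` / `PfPersistenceFfGram` (pub-weilobs `FF.md` §1): a datum `(q, A)`,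
normalised roots `U = A/√q` (`normRoots q A`), Toeplitz symbol `K(n) = ½ Σ_{u ∈ U} u^n`, window forms
`T_M = (K(|m - m'|))_{0 ≤ m, m' ≤ M}` (`ffWindowForm q A M`; `weilWindowForm q h M` for the characteristic
polynomial of Frobenius `h ∈ ℤ[x]`, `A = frobRoots h`).  Throughout, the datum is RH-TRUE (`U` unimodular)
and REAL (`U` closed under complex conjugation; automatic for `h ∈ ℤ[x]`).  Write
`D := #{distinct elements of U}` (`(normRoots q A).toFinset.card`; for `(q, h)` with `q > 0` this is the
number of distinct complex roots of `h`, `toFinset_card_normRoots`) and `rad_U(z) := ∏_{w ∈ U, distinct} (z - w)`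
(the RADICAL of the normalised `L`-polynomial; `= ∏_{u ∈ U}(z - u)` iff the roots are simple, `D = #A = 2g`).

`PfPersistenceFfGram` treats SIMPLE roots: `T_M ≻ 0` for `M + 1 ≤ #A` under `Nodup`, and the kernel
vectors `z^j ∏_{u ∈ U}(z - u)` from `M = #A` on.  Repeated Frobenius eigenvalues are the rule, not the
exception, for the extremal objects of the calibration panel (Weil-maximal/minimal curves `P̃ = (1 ± z)^{2g}`,
the Hermitian curve `(1 + 3T)^6`, `E × E`, base changes; 77 of the 670 calibration objects), and there the
cliff sits at `D < 2g`.  This file proves the general-multiplicity statements ([folklore] algebra: the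
finitely-atomic case of the Carathéodory–Toeplitz picture — the symbol is the moment sequence of the
measure `½ Σ_u δ_u` on the circle, whose support has `D` points; compare Hallouin–Perret, Trans. AMS 372
(2019) App. A.2.1 Lemma 33 for the rank of a PSD Toeplitz matrix; recorded as exact DATA in every row of
pub-weilobs `FF.md` T2 "the form only sees the radical" and found BLIND on 670/670 objects in FFCAL.md A2):

* `ffWindowForm_mulVec_eq_zero_iff` (THE KERNEL): `T_M c = 0 ↔` the polynomial `Σ_m c_m z^m` vanishes at
  every normalised root — equivalently (`ffWindowForm_mulVec_eq_zero_iff_radical_dvd`) `rad_U ∣ Σ_m c_m z^m`: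
  the kernel of the window of degree `M ≥ D` is EXACTLY `rad_U · ℂ[z]_{≤ M - D}` (FFCAL.md A2/A3: the
  Castelnuovo–Severi equality classes seen by the window are the multiples of the radical).
* `ffWindowForm_posDef_iff` (THE CLIFF): `T_M ≻ 0 ↔ M + 1 ≤ D`, and `ffWindowForm_det_eq_zero_iff`:
  `det T_M = 0 ↔ D ≤ M` — the first window with `ε₁ = 0` is `M = D`, for every multiplicity pattern.
* the same for the datum `(q, h)`: `weilWindowForm_mulVec_eq_zero_iff`, `weilWindowForm_posDef_iff`,
  `weilWindowForm_det_eq_zero_iff`, with `D = (frobRoots h).toFinset.card`.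
* (companion file `MotivicDoorFfLatticeFloorCliff`) THE LATTICE FLOOR WITHOUT `Nodup`: for MONIC `h ∈ ℤ[x]`
  with all roots of absolute value `√q` and EVERY pre-cliff window `M + 1 ≤ D`, the determinant and Loewner
  floors of `MotivicDoorFfLatticeFloor` (`1 ≤ q^{Σ m} 2^{M+1} det T_M`, `T_M - latticeFloor q (deg h) M · 1 ⪰ 0`),
  there under `Nodup` and `M + 1 ≤ deg h`, follow from `weilWindowForm_posDef_iff` below.

DATA context (not used in any proof): FFCAL.md §0 — blind cliff `D̂ = D` on 670/670 objects (505 exact +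
165 synthetic), kernel line `ω ≤ 5.0e-40`, post-cliff minimisers inside `span{z^j rad P̃}` to `ρ ≤ 4.6e-39`,
lattice floor certified on 2332/2332 pre-cliff windows.  No RH claim in either direction.
-/

set_option linter.dupNamespace false  -- the mandated namespace repeats `RiemannHypothesis`

noncomputable section

open Polynomial Matrix Finset
open scoped ComplexOrder ComplexConjugate

namespace Summit.RiemannHypothesis.RiemannHypothesis.Theorems.MotivicDoor.FfCliff

open Summit.RiemannHypothesis.RiemannHypothesis.Theorems.PfPersistence.FfAngleTwin

variable {ι : Type*} [Fintype ι]

/-! ## The kernel of the window form -/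

omit [Fintype ι] in
/-- Kernel of the adjoint Gram factor: `Wᴴ c = 0 ↔` the polynomial with coefficient vector `c` vanishes at
every conjugate root `conj(u_i)`. [folklore] -/
theorem gram_conjTranspose_mulVec_eq_zero_iff (u : ι → ℂ) (M : ℕ) (c : Fin (M + 1) → ℂ) :
    (Matrix.of fun (r : Fin (M + 1)) (j : ι) => u j ^ (r : ℕ) / (Real.sqrt 2 : ℂ))ᴴ *ᵥ c = 0 ↔
      ∀ i, ∑ m : Fin (M + 1), c m * conj (u i) ^ (m : ℕ) = 0 := by
  have hs2 : (Real.sqrt 2 : ℂ) ≠ 0 := by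
    exact_mod_cast (Real.sqrt_pos.2 (by norm_num : (0:ℝ) < 2)).ne'
  rw [funext_iff]
  refine forall_congr' fun i => ?_
  rw [gram_conjTranspose_mulVec, Pi.zero_apply, div_eq_zero_iff, or_iff_left hs2]

/-- THE KERNEL OF THE WINDOW FORM (RH-true, real datum; every window `M`, every multiplicity pattern):
`T_M(q, A) c = 0` iff the polynomial `Σ_{m ≤ M} c_m z^m` vanishes at every normalised root `u ∈ A/√q`.
(`T_M = W Wᴴ`, so `ker T_M = ker Wᴴ`; `Wᴴ c` lists the values at the conjugate roots, and the root multiset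
is conjugation-closed.) [folklore] -/
theorem ffWindowForm_mulVec_eq_zero_iff {q : ℝ} {A : Multiset ℂ} (hmod : ∀ z ∈ normRoots q A, ‖z‖ = 1)
    (hconj : (normRoots q A).map conj = normRoots q A) {M : ℕ} (c : Fin (M + 1) → ℂ) :
    ffWindowForm q A M *ᵥ c = 0 ↔ ∀ z ∈ normRoots q A, ∑ m : Fin (M + 1), c m * z ^ (m : ℕ) = 0 := by
  obtain ⟨k, u, hU⟩ := exists_eq_univ_val_map (normRoots q A)
  rw [ffWindowForm_eq_gram hU hmod hconj M, Matrix.self_mul_conjTranspose_mulVec_eq_zero,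
    gram_conjTranspose_mulVec_eq_zero_iff]
  constructor
  · intro h z hz
    have hz' : conj z ∈ normRoots q A := by
      rw [← hconj]; exact Multiset.mem_map_of_mem _ hz
    rw [← hU, Multiset.mem_map] at hz'
    obtain ⟨i, -, hi⟩ := hz'
    have hzi : conj (u i) = z := by rw [hi, Complex.conj_conj]
    rw [← hzi]; exact h i
  · intro h i
    apply h
    rw [← hconj]; exact Multiset.mem_map_of_mem _ (mem_of_univ_val_map hU i)

/-- `#U.dedup = #(distinct elements of U)`. [folklore] -/
theorem card_dedup_eq_toFinset_card (U : Multiset ℂ) : Multiset.card U.dedup = U.toFinset.card := rfl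

/-- THE RADICAL IS IN THE KERNEL FROM THE CLIFF ON: for `M ≥ D + j` the coefficient vector of
`z^j · rad_U(z)`, `rad_U = ∏_{w ∈ U distinct}(z - w)`, is killed by `T_M(q, A)`. [folklore] -/
theorem ffWindowForm_mulVec_radical_eq_zero {q : ℝ} {A : Multiset ℂ}
    (hmod : ∀ z ∈ normRoots q A, ‖z‖ = 1) (hconj : (normRoots q A).map conj = normRoots q A)
    {M j : ℕ} (hM : (normRoots q A).toFinset.card + j ≤ M) :
    ffWindowForm q A M *ᵥ
      (fun m => (X ^ j * ((normRoots q A).dedup.map fun w => X - C w).prod).coeff m) = 0 := by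
  rw [ffWindowForm_mulVec_eq_zero_iff hmod hconj]
  intro z hz
  set p : ℂ[X] := ((normRoots q A).dedup.map fun w => X - C w).prod with hp
  have hdeg : (X ^ j * p).natDegree ≤ M := by
    calc (X ^ j * p).natDegree ≤ (X ^ j : ℂ[X]).natDegree + p.natDegree := natDegree_mul_le
      _ ≤ j + (normRoots q A).toFinset.card := by
          rw [hp, natDegree_multiset_prod_X_sub_C_eq_card, card_dedup_eq_toFinset_card]
          exact add_le_add (natDegree_X_pow_le j) le_rfl
      _ ≤ M := by omega
  rw [sum_fin_coeff_mul_pow hdeg, eval_mul, eval_rootPoly_eq_zero (Multiset.mem_dedup.2 hz), mul_zero]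

/-- Beyond the cliff the window is singular: `D ≤ M ⇒ det T_M(q, A) = 0`. [folklore] -/
theorem ffWindowForm_det_eq_zero_of_card_le {q : ℝ} {A : Multiset ℂ}
    (hmod : ∀ z ∈ normRoots q A, ‖z‖ = 1) (hconj : (normRoots q A).map conj = normRoots q A)
    {M : ℕ} (hM : (normRoots q A).toFinset.card ≤ M) : (ffWindowForm q A M).det = 0 := by
  refine Matrix.exists_mulVec_eq_zero_iff.1 ⟨_, rootPolyCoeff_ne_zero (normRoots q A).dedup (j := 0) ?_,
    ffWindowForm_mulVec_radical_eq_zero hmod hconj (j := 0) (by simpa using hM)⟩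
  rw [card_dedup_eq_toFinset_card]; simpa using hM

/-! ## Definiteness below the cliff -/

/-- The Gram factor has injective `vecMul` as soon as the root family takes at least `M + 1` DISTINCT values
(a nonzero polynomial of degree `≤ M` cannot vanish at `M + 1` points; multiplicities are irrelevant).
Generalises `gram_vecMul_injective` (injective family). [folklore] -/
theorem gram_vecMul_injective_of_le_card {u : ι → ℂ} {U : Multiset ℂ} (hU : univ.val.map u = U)
    {M : ℕ} (hM : M + 1 ≤ U.toFinset.card) :
    Function.Injective
      (Matrix.of fun (r : Fin (M + 1)) (j : ι) => u j ^ (r : ℕ) / (Real.sqrt 2 : ℂ)).vecMul := by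
  have hs2 : (Real.sqrt 2 : ℂ) ≠ 0 := by
    exact_mod_cast (Real.sqrt_pos.2 (by norm_num : (0:ℝ) < 2)).ne'
  intro x y hxy
  rw [← sub_eq_zero]
  set d : Fin (M + 1) → ℂ := x - y with hd
  have hd0 :
      d ᵥ* (Matrix.of fun (r : Fin (M + 1)) (j : ι) => u j ^ (r : ℕ) / (Real.sqrt 2 : ℂ)) = 0 := by
    rw [hd, Matrix.sub_vecMul]; exact sub_eq_zero.2 hxy
  set r : ℂ[X] := ∑ m : Fin (M + 1), C (d m) * X ^ (m : ℕ) with hr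
  have hdeg : r.natDegree ≤ M :=
    natDegree_sum_le_of_forall_le _ _ fun m _ =>
      (natDegree_C_mul_X_pow_le (d m) m).trans (Nat.lt_succ_iff.1 m.isLt)
  have heval : ∀ i, r.eval (u i) = 0 := by
    intro i
    have hi := congr_fun hd0 i
    simp only [Matrix.vecMul, dotProduct, Matrix.of_apply, Pi.zero_apply] at hi
    have hi' : (∑ m : Fin (M + 1), d m * u i ^ (m : ℕ)) / (Real.sqrt 2 : ℂ) = 0 := by
      rw [Finset.sum_div]
      refine (Finset.sum_congr rfl fun m _ => ?_).trans hi
      ring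
    rw [div_eq_zero_iff] at hi'
    rcases hi' with hi' | hi'
    · rw [hr, eval_finsetSum]
      simpa only [eval_mul, eval_C, eval_pow, eval_X] using hi'
    · exact absurd hi' hs2
  have heval' : ∀ z ∈ U.toFinset, r.eval z = 0 := by
    intro z hz
    rw [Multiset.mem_toFinset, ← hU, Multiset.mem_map] at hz
    obtain ⟨i, -, rfl⟩ := hz
    exact heval i
  have hr0 : r = 0 :=
    eq_zero_of_natDegree_lt_card_of_eval_eq_zero' r U.toFinset heval' (by omega)
  funext m
  have hm : r.coeff m = d m := by
    rw [hr, finsetSum_coeff]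
    simp only [coeff_C_mul_X_pow]
    rw [Finset.sum_eq_single m]
    · simp
    · intro b _ hb
      rw [if_neg]
      exact fun h => hb (Fin.ext h.symm)
    · intro h; exact absurd (mem_univ m) h
  rw [← hm, hr0, coeff_zero, Pi.zero_apply]

/-- Below the cliff the window is positive definite: `M + 1 ≤ D ⇒ T_M(q, A) ≻ 0`, repeated roots
allowed. [folklore] -/
theorem ffWindowForm_posDef_of_le_card {q : ℝ} {A : Multiset ℂ}
    (hmod : ∀ z ∈ normRoots q A, ‖z‖ = 1) (hconj : (normRoots q A).map conj = normRoots q A)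
    {M : ℕ} (hM : M + 1 ≤ (normRoots q A).toFinset.card) : (ffWindowForm q A M).PosDef := by
  obtain ⟨k, u, hU⟩ := exists_eq_univ_val_map (normRoots q A)
  rw [ffWindowForm_eq_gram hU hmod hconj M]
  exact Matrix.PosDef.mul_conjTranspose_self _ (gram_vecMul_injective_of_le_card hU hM)

/-! ## The cliff -/

/-- THE CLIFF (definiteness form): on an RH-true real datum, `T_M(q, A) ≻ 0 ↔ M + 1 ≤ D`,
`D` the number of DISTINCT normalised roots. [folklore] -/
theorem ffWindowForm_posDef_iff {q : ℝ} {A : Multiset ℂ}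
    (hmod : ∀ z ∈ normRoots q A, ‖z‖ = 1) (hconj : (normRoots q A).map conj = normRoots q A) {M : ℕ} :
    (ffWindowForm q A M).PosDef ↔ M + 1 ≤ (normRoots q A).toFinset.card := by
  classical
  refine ⟨fun hpd => ?_, ffWindowForm_posDef_of_le_card hmod hconj⟩
  by_contra hlt
  exact hpd.det_pos.ne' (ffWindowForm_det_eq_zero_of_card_le hmod hconj (M := M) (by omega))

/-- THE CLIFF (determinant form): `det T_M(q, A) = 0 ↔ D ≤ M`. [folklore] -/
theorem ffWindowForm_det_eq_zero_iff {q : ℝ} {A : Multiset ℂ}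
    (hmod : ∀ z ∈ normRoots q A, ‖z‖ = 1) (hconj : (normRoots q A).map conj = normRoots q A) {M : ℕ} :
    (ffWindowForm q A M).det = 0 ↔ (normRoots q A).toFinset.card ≤ M := by
  classical
  refine ⟨fun h => ?_, ffWindowForm_det_eq_zero_of_card_le hmod hconj⟩
  by_contra hlt
  exact (ffWindowForm_posDef_of_le_card hmod hconj (M := M) (by omega)).det_pos.ne' h

/-- THE KERNEL IS THE RADICAL (divisibility form): `T_M(q, A) c = 0 ↔ rad_U ∣ Σ_m c_m z^m`; with the
cliff, `ker T_M = rad_U · ℂ[z]_{≤ M - D}` for `M ≥ D` and `= 0` for `M < D`. [folklore] -/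
theorem ffWindowForm_mulVec_eq_zero_iff_radical_dvd {q : ℝ} {A : Multiset ℂ}
    (hmod : ∀ z ∈ normRoots q A, ‖z‖ = 1) (hconj : (normRoots q A).map conj = normRoots q A)
    {M : ℕ} (c : Fin (M + 1) → ℂ) :
    ffWindowForm q A M *ᵥ c = 0 ↔
      ((normRoots q A).dedup.map fun w => X - C w).prod ∣ ∑ m : Fin (M + 1), C (c m) * X ^ (m : ℕ) := by
  rw [ffWindowForm_mulVec_eq_zero_iff hmod hconj]
  have heval : ∀ z, (∑ m : Fin (M + 1), C (c m) * X ^ (m : ℕ)).eval z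
      = ∑ m : Fin (M + 1), c m * z ^ (m : ℕ) := by
    intro z; rw [eval_finsetSum]; simp only [eval_mul, eval_C, eval_pow, eval_X]
  by_cases hr0 : (∑ m : Fin (M + 1), C (c m) * X ^ (m : ℕ)) = 0
  · refine iff_of_true (fun z _ => ?_) (by rw [hr0]; exact dvd_zero _)
    rw [← heval, hr0, eval_zero]
  · rw [Multiset.prod_X_sub_C_dvd_iff_le_roots hr0, Multiset.le_iff_subset (Multiset.nodup_dedup _)]
    constructor
    · intro h z hz
      exact (mem_roots hr0).2 (by rw [IsRoot.def, heval]; exact h z (Multiset.mem_dedup.1 hz))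
    · intro h z hz
      have hz' := h (Multiset.mem_dedup.2 hz)
      rwa [mem_roots hr0, IsRoot.def, heval] at hz'

/-! ## Dictionary with integer polynomials: the datum `(q, h)` -/

/-- Normalising by `√q ≠ 0` does not merge roots: `D(A/√q) = D(A)`. [folklore] -/
theorem toFinset_card_normRoots {q : ℝ} (hq : 0 < q) (A : Multiset ℂ) :
    (normRoots q A).toFinset.card = A.toFinset.card := by
  have hs : (Real.sqrt q : ℂ) ≠ 0 := by exact_mod_cast (Real.sqrt_pos.2 hq).ne'
  rw [normRoots, Multiset.toFinset_map, Finset.card_image_of_injective]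
  exact fun a b hab => (div_left_inj' hs).1 hab

/-- THE KERNEL for `(q, h)` (RH-true `h`): `T_M(q, h) c = 0 ↔ Σ_m c_m (α/√q)^m = 0` for every complex root
`α` of `h`. [folklore] -/
theorem weilWindowForm_mulVec_eq_zero_iff {q : ℝ} (hq : 0 < q) {h : ℤ[X]}
    (hRH : ∀ α ∈ frobRoots h, ‖α‖ = Real.sqrt q) {M : ℕ} (c : Fin (M + 1) → ℂ) :
    weilWindowForm q h M *ᵥ c = 0 ↔
      ∀ α ∈ frobRoots h, ∑ m : Fin (M + 1), c m * (α / (Real.sqrt q : ℂ)) ^ (m : ℕ) = 0 := by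
  have key := ffWindowForm_mulVec_eq_zero_iff (normRoots_norm_eq_one hq hRH)
    (normRoots_frobRoots_map_conj q h) c
  rw [weilWindowForm, key, normRoots, Multiset.forall_mem_map_iff]

/-- THE CLIFF for `(q, h)`: RH ⇒ (`T_M(q, h) ≻ 0 ↔ M + 1 ≤ D`), `D` = number of distinct complex roots
of `h`. [folklore] -/
theorem weilWindowForm_posDef_iff {q : ℝ} (hq : 0 < q) {h : ℤ[X]}
    (hRH : ∀ α ∈ frobRoots h, ‖α‖ = Real.sqrt q) {M : ℕ} :
    (weilWindowForm q h M).PosDef ↔ M + 1 ≤ (frobRoots h).toFinset.card := by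
  rw [← toFinset_card_normRoots hq]
  exact ffWindowForm_posDef_iff (normRoots_norm_eq_one hq hRH) (normRoots_frobRoots_map_conj q h)

/-- THE CLIFF for `(q, h)`, determinant form: RH ⇒ (`det T_M(q, h) = 0 ↔ D ≤ M`). [folklore] -/
theorem weilWindowForm_det_eq_zero_iff {q : ℝ} (hq : 0 < q) {h : ℤ[X]}
    (hRH : ∀ α ∈ frobRoots h, ‖α‖ = Real.sqrt q) {M : ℕ} :
    (weilWindowForm q h M).det = 0 ↔ (frobRoots h).toFinset.card ≤ M := by
  rw [← toFinset_card_normRoots hq]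
  exact ffWindowForm_det_eq_zero_iff (normRoots_norm_eq_one hq hRH) (normRoots_frobRoots_map_conj q h)

end Summit.RiemannHypothesis.RiemannHypothesis.Theorems.MotivicDoor.FfCliff

end
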